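import Summits.QuantumFields.YangMills.Theorems.UnitScaleTiltProp7FlatInteriorMeanValue
import Summits.QuantumFields.YangMills.Theorems.UnitScaleTiltProp7FlatDirichletSup
import Literature.MathematicalPhysics.QuantumFieldTheory.Balaban1983to89.B4Eq19LatticeDirichletZero
import HarnessLib

/-!
# Route R of crux K1 «MinimiserStabilityRegPr» (stmt-QuantumFields-19200) — THE SOURCED INTERIOR MEAN-VALUE ESTIMATE, FLAT AND LINEAR:
# `−Δu = ∂*g` on `Q_R(z)`, `|g| ≤ m` ⟹ `u(x)² ≤ 4K·Σ_{Q_R(z)} u² + C·R²·m²` (`K ≍ ℓ^{−d}`), AND ITS READING FOR BOND FIELDS WITH BOUNDED CURL AND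
# DIVERGENCE, ON `ℤ^d` AND ON EVERY TORUS `T^{(j)}` (brick 2c — the assembly; cell `ym3-torus`, width seat `ym-ust-19200-w1` g6; OWNER ACK 22 (a);
# `--supports stmt-QuantumFields-19200 --as helper`, count-neutral)

YM₃ on T³ is a RUNG of the ladder (R3), not the Clay problem; nothing here claims the stub, the crux or the gap.

WHY.  Route R's nonlinear passage (CARD-19200-V3-g11 §6 (S3)∕(S3′)) and the `ℓ²` reading of the `Q^{(k)}`-defect source (`Prop7FibreQDefect(Ell2)`) display
an interior regularity input of mean-value type — a local sup of the representative against its local mass on an ENLARGED neighbourhood.  For a field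
that is only APPROXIMATELY curl- and divergence-free (the nonlinear representative: curl `= O(ε₀ℓ⁻²) + O(Y²)`, divergence `= O(Y²)` off the centres) the
right statement carries the sources at the scaling `ℓ·(sup|curl| + sup|∂*Y|)`.  This file assembles it from the three bricks: harmonic replacement on the
box (`B4Eq19LatticeDirichletZero.exists_dirichlet_zero`), the `L² → L^∞` bound for the harmonic part (brick 1 `Prop7FlatInteriorMeanValue.sq_le_of_harmonic`),
and the `L^∞` bound for the Dirichlet corrector with divergence-form data (brick 2b `Prop7FlatDirichletSup.abs_le_of_dirichlet`, via the lattice Faber–Krahn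
inequality of brick 2a and the level iteration of brick 2b-i).

WHAT IS PROVED (sorry-free, no definition; `K := 2^d(1+56d)^d∕(ℓ+1)^d`, `R := ρ₀ + ℓ + d(ℓ+2)`, `D := 64·2^d·d·m·(2R+1)`).
* §1 ★★ `sq_le_of_lop_eq_dvg` (`ℤ^d`, scalar) — `d ≥ 1`, `ℓ ≥ 1`, `ρ₀ ≥ 0`; if `lop 0 u = dvg g` on `Q_R(z)` and `|g(y,μ)| ≤ m` for `y ∈ Q_{R+1}(z)`, then
  for every `x ∈ Q_{ρ₀}(z)`: `u(x)² ≤ 4K·Σ_{y ∈ Q_R(z)} u(y)² + (4K·(2R+1)^d + 2)·D²` — i.e. `sup_{Q_{ρ₀}} u² ≲_d ℓ^{−d}·Σ_{Q_R}u² + ℓ²m²`.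
* §2 `dvg_add'`, `dvg_diag_shift` (bookkeeping), ★★ `sq_le_of_curl_div_bounds` (`ℤ^d`, bond fields `X : ℤ^d → Fin d → ℝ`) — if the plaquette variable
  `|X(y,ν) + X(y+e_ν,μ) − X(y+e_μ,ν) − X(y,μ)| ≤ c₁` for `y ∈ Q_{R+1}(z)` and `|∂*X(y)| ≤ c₂` for `y ∈ Q_{R+2}(z)`, then for `x ∈ Q_{ρ₀}(z)` and every `μ`:
  `X(x,μ)² ≤ 4K·Σ_{y ∈ Q_R(z)} X(y,μ)² + (4K·(2R+1)^d + 2)·(64·2^d·d·(c₁+c₂)·(2R+1))²` (brick 1's Weitzenböck identity puts both sources in divergence form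
  `−ΔX_μ = ∂*G_μ`, `G_μ(y,ν) = C_X(y;ν,μ) − [ν = μ]·∂*X(y+e_μ)`, `|G_μ| ≤ c₁ + c₂`).
* §3 (torus `T^{(j)}` of `Setup`, letters `LatticeFieldCalculus.curl∕diverg 1`, periodic pullback along `B10Eq27TorusAxialLog.transl x₀`):
  `abs_plaq_le_of_abs_curl_le`; ★★ `sq_le_of_curl_diverg_bounds_torus` — `|curl 1 X| ≤ c₁` on the plaquettes based in `transl x₀ '' Q_{R+1}(0)` and
  `|diverg 1 X| ≤ c₂` on `transl x₀ '' Q_{R+2}(0)` ⟹ for `z′ ∈ Q_{ρ₀}(0)`, `μ`: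
  `X⟨transl x₀ z′, μ⟩² ≤ 4K·Σ_{w ∈ Q_R(0)} X⟨transl x₀ w, μ⟩² + (4K·(2R+1)^d + 2)·(64·2^d·d·(c₁+c₂)·(2R+1))²` (no period∕injectivity hypothesis).
READING FOR THE CONSUMER (d = 3, `ℓ = L^k`): `R ≤ (11L^k+11)/2`, `K·(2R+1)³ ≤ 8·169³·12³` — a pure number — so the estimate is
`sup² ≤ C·(L^k)⁻³·mass(17³ blocks) + C′·(L^k)²·(sup|curl| + sup|∂*Y|)²`, k-UNIFORM; with `sup|curl| ≲ ε₀L^{−2k}` the source term is `(ε₀L^{−k})²`, the scale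
of the target sup bound itself.

HONEST SCOPE.  [folklore] lattice analysis ([Giaquinta1984] Ch. III; De Giorgi ∕ Stampacchia), flat and LINEAR with crude constants; the nonlinear bootstrap
(sources quadratic in the field), the centre charges of the pinned representative and every covariant statement are NOT here (★p1's fork ∕ the S3 passage).
Nothing of [Balaban1985Variational] ∕ [Balaban1984PropagatorsII] is asserted.

References: M. Giaquinta, *Multiple integrals in the calculus of variations and nonlinear elliptic systems*, Princeton UP 1983 [Giaquinta1984] (Ch. III §1–2);
T. Bałaban, CMP 95 (1984) 17–40 [Balaban1984PropagatorsI] ((1.21) p.21); CMP 96 (1984) 223–250 [Balaban1984PropagatorsII] ((1.9) p.226); CMP 102 (1985)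
277–309 [Balaban1985Variational] (Prop. 7 p.299).
-/

set_option autoImplicit false

noncomputable section

open scoped BigOperators
open Finset

namespace Summit.QuantumFields.YangMills.Theorems.Prop7FlatSourcedMeanValue

open Literature.MathematicalPhysics.QuantumFieldTheory.Balaban1983to89
open B4Eq19LatticeOperators B4Eq19LatticeDirichletReplacement B4Eq19LatticeDirichletZero
open LatticeFieldCalculus (curl diverg)
open B10Eq27TorusAxialLog (transl)
open Summit.QuantumFields.YangMills.Theorems.Prop7FlatInteriorMeanValue (sq_le_of_harmonic lop_comp_eq_dvg_add_fdiff_dvg plaq_pullback_eq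
  dvg_pullback_eq_diverg plaq_eq_curl plaq_eq_neg_curl plaq_self)
open Summit.QuantumFields.YangMills.Theorems.Prop7FlatDirichletSup (abs_le_of_dirichlet)

/-! ## §1 The sourced mean-value estimate for `−Δu = ∂*g` on `ℤ^d` -/

section Zd

variable {d : ℕ}

/-- ★★ **THE SOURCED INTERIOR MEAN-VALUE ESTIMATE ON `ℤ^d`.**  `d ≥ 1`, `ℓ ≥ 1`, `ρ₀ ≥ 0`, `R := ρ₀ + ℓ + d(ℓ+2)`, `m ≥ 0`; if `−Δu = ∂*g` on `Q_R(z)`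
(`lop 0 u = dvg g`) and `|g(y,μ)| ≤ m` for `y ∈ Q_{R+1}(z)`, then for every `x ∈ Q_{ρ₀}(z)`, with `K = 2^d(1+56d)^d(ℓ+1)^{−d}` and `D = 64·2^d·d·m·(2R+1)`:
`u(x)² ≤ 4K·Σ_{y ∈ Q_R(z)} u(y)² + (4K(2R+1)^d + 2)·D²`.  Proof: `u = h + w` with `w` the box Dirichlet corrector (`w = 0` off `Q_R(z)`, `−Δw = ∂*g` on it,
`|w| ≤ D` by brick 2b) and `h` harmonic on `Q_R(z)` (`h(x)² ≤ K·Σ h²` by brick 1); `Σ_{Q_R} h² ≤ 2Σu² + 2(2R+1)^d D²`. [folklore]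
[cite: Giaquinta1984, Ch. III §2 (2.5) p.78; Balaban1984PropagatorsII, (1.9) p.226] -/
theorem sq_le_of_lop_eq_dvg (hd : 1 ≤ d) {z : Zd d} {ℓ : ℕ} (hℓ : 1 ≤ ℓ) {ρ₀ : ℤ} (hρ₀ : 0 ≤ ρ₀) (u : Zd d → ℝ) (g : Zd d → Fin d → ℝ)
    {m : ℝ} (hm : 0 ≤ m) (hEq : ∀ y ∈ box z (ρ₀ + ℓ + d * ((ℓ : ℤ) + 2)), lop 0 u y = dvg g y)
    (hg : ∀ y ∈ box z (ρ₀ + ℓ + d * ((ℓ : ℤ) + 2) + 1), ∀ μ, |g y μ| ≤ m) {x : Zd d} (hx : x ∈ box z ρ₀) :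
    u x ^ 2 ≤ 4 * ((2 : ℝ) ^ d * (1 + 56 * d) ^ d / ((ℓ : ℝ) + 1) ^ d) * ∑ y ∈ box z (ρ₀ + ℓ + d * ((ℓ : ℤ) + 2)), u y ^ 2 +
      (4 * ((2 : ℝ) ^ d * (1 + 56 * d) ^ d / ((ℓ : ℝ) + 1) ^ d) * (2 * ((ρ₀ + ℓ + d * ((ℓ : ℤ) + 2) : ℤ) : ℝ) + 1) ^ d + 2) *
        (64 * (2 : ℝ) ^ d * d * m * (2 * ((ρ₀ + ℓ + d * ((ℓ : ℤ) + 2) : ℤ) : ℝ) + 1)) ^ 2 := by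
  classical
  set R : ℤ := ρ₀ + ℓ + d * ((ℓ : ℤ) + 2) with hRdef
  set K : ℝ := (2 : ℝ) ^ d * (1 + 56 * d) ^ d / ((ℓ : ℝ) + 1) ^ d with hKdef
  set D : ℝ := 64 * (2 : ℝ) ^ d * d * m * (2 * (R : ℝ) + 1) with hDdef
  have hR0 : 0 ≤ R := by rw [hRdef]; positivity
  have hK0 : 0 ≤ K := by rw [hKdef]; positivity
  -- the Dirichlet corrector and the harmonic part
  obtain ⟨w, hw0, hw⟩ := exists_dirichlet_zero (by omega) z R (dvg g)
  set h : Zd d → ℝ := fun y => u y - w y with hhdef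
  have hharm : ∀ y ∈ box z R, lop 0 h y = 0 := fun y hy => by
    rw [hhdef, lop_sub, hEq y hy, hw y hy, sub_self]
  have hD : ∀ y, |w y| ≤ D := fun y => abs_le_of_dirichlet hd hR0 g hm hw0 hw hg y
  have hD0 : 0 ≤ D := le_trans (abs_nonneg _) (hD x)
  -- brick 1 on `h`
  have hmv : h x ^ 2 ≤ K * ∑ y ∈ box z R, h y ^ 2 := sq_le_of_harmonic (κ := 0) le_rfl hℓ hρ₀ h hharm hx
  -- the mass of `h`
  have hcard : ((box z R).card : ℝ) = (2 * (R : ℝ) + 1) ^ d := by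
    rw [card_box z hR0]; push_cast; ring
  have hmass : ∑ y ∈ box z R, h y ^ 2 ≤ 2 * ∑ y ∈ box z R, u y ^ 2 + 2 * (2 * (R : ℝ) + 1) ^ d * D ^ 2 := by
    have hpt : ∀ y ∈ box z R, h y ^ 2 ≤ 2 * u y ^ 2 + 2 * D ^ 2 := fun y _ => by
      have hwy : w y ^ 2 ≤ D ^ 2 := by
        have := hD y
        rw [abs_le] at this
        nlinarith [this.1, this.2]
      have : h y = u y - w y := rfl
      nlinarith [sq_nonneg (u y + w y)]
    calc ∑ y ∈ box z R, h y ^ 2 ≤ ∑ y ∈ box z R, (2 * u y ^ 2 + 2 * D ^ 2) := Finset.sum_le_sum hpt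
      _ = 2 * ∑ y ∈ box z R, u y ^ 2 + 2 * (2 * (R : ℝ) + 1) ^ d * D ^ 2 := by
          rw [Finset.sum_add_distrib, ← Finset.mul_sum, Finset.sum_const, nsmul_eq_mul, hcard]; ring
  -- assemble
  have hux : u x = h x + w x := by simp [hhdef]
  have hwx : w x ^ 2 ≤ D ^ 2 := by
    have := hD x
    rw [abs_le] at this
    nlinarith [this.1, this.2]
  have hS0 : 0 ≤ ∑ y ∈ box z R, u y ^ 2 := Finset.sum_nonneg fun _ _ => sq_nonneg _
  calc u x ^ 2 = (h x + w x) ^ 2 := by rw [hux]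
    _ ≤ 2 * h x ^ 2 + 2 * w x ^ 2 := by nlinarith [sq_nonneg (h x - w x)]
    _ ≤ 2 * (K * (2 * ∑ y ∈ box z R, u y ^ 2 + 2 * (2 * (R : ℝ) + 1) ^ d * D ^ 2)) + 2 * D ^ 2 := by
        nlinarith [mul_le_mul_of_nonneg_left hmass hK0]
    _ = 4 * K * ∑ y ∈ box z R, u y ^ 2 + (4 * K * (2 * (R : ℝ) + 1) ^ d + 2) * D ^ 2 := by ring

/-! ## §2 Bond fields on `ℤ^d` with bounded curl and divergence -/

/-- The lattice divergence is additive. [folklore] -/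
theorem dvg_add' (g₁ g₂ : Zd d → Fin d → ℝ) (y : Zd d) :
    dvg (fun x ν => g₁ x ν + g₂ x ν) y = dvg g₁ y + dvg g₂ y := by
  simp only [dvg_apply, ← Finset.sum_add_distrib]
  exact Finset.sum_congr rfl fun ν _ => by ring

/-- The divergence of the diagonal bond field `(y, ν) ↦ [ν = μ]·(−F(y + e_μ))` is the forward difference `∂_μF`. [folklore] -/
theorem dvg_diag_shift (F : Zd d → ℝ) (μ : Fin d) (y : Zd d) :
    dvg (fun x ν => if ν = μ then -F (x + unitVec μ) else 0) y = fdiff μ F y := by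
  classical
  rw [dvg_apply, fdiff_apply, Finset.sum_eq_single μ]
  · simp only [if_true, sub_add_cancel]; ring
  · intro ν _ hν; simp only [if_neg hν, sub_self]
  · intro h; exact absurd (Finset.mem_univ μ) h

/-- ★★ **THE SOURCED MEAN-VALUE ESTIMATE FOR BOND FIELDS ON `ℤ^d`.**  `d ≥ 1`, `ℓ ≥ 1`, `ρ₀ ≥ 0`, `R := ρ₀ + ℓ + d(ℓ+2)`; if the plaquette variable
of `X` is bounded by `c₁` on the plaquettes based in `Q_{R+1}(z)` and `|∂*X| ≤ c₂` on `Q_{R+2}(z)` (`c₁, c₂ ≥ 0`), then for `x ∈ Q_{ρ₀}(z)` and every `μ`: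
`X(x,μ)² ≤ 4K·Σ_{y ∈ Q_R(z)} X(y,μ)² + (4K(2R+1)^d + 2)·(64·2^d·d·(c₁+c₂)·(2R+1))²` (brick 1's Weitzenböck identity `−ΔX_μ = ∂*G_μ` with
`G_μ(y,ν) = C_X(y;ν,μ) − [ν=μ]·∂*X(y+e_μ)`, `|G_μ| ≤ c₁ + c₂`, then §1). [folklore]
[cite: Giaquinta1984, Ch. III §2 (2.5) p.78; Balaban1984PropagatorsI, (1.21) p.21] -/
theorem sq_le_of_curl_div_bounds (hd : 1 ≤ d) {z : Zd d} {ℓ : ℕ} (hℓ : 1 ≤ ℓ) {ρ₀ : ℤ} (hρ₀ : 0 ≤ ρ₀) (X : Zd d → Fin d → ℝ)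
    {c₁ c₂ : ℝ} (hc₁ : 0 ≤ c₁) (hc₂ : 0 ≤ c₂)
    (hC : ∀ y ∈ box z (ρ₀ + ℓ + d * ((ℓ : ℤ) + 2) + 1), ∀ ν μ : Fin d, |X y ν + X (y + unitVec ν) μ - X (y + unitVec μ) ν - X y μ| ≤ c₁)
    (hDv : ∀ y ∈ box z (ρ₀ + ℓ + d * ((ℓ : ℤ) + 2) + 2), |dvg X y| ≤ c₂)
    {x : Zd d} (hx : x ∈ box z ρ₀) (μ : Fin d) :
    X x μ ^ 2 ≤ 4 * ((2 : ℝ) ^ d * (1 + 56 * d) ^ d / ((ℓ : ℝ) + 1) ^ d) * ∑ y ∈ box z (ρ₀ + ℓ + d * ((ℓ : ℤ) + 2)), X y μ ^ 2 +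
      (4 * ((2 : ℝ) ^ d * (1 + 56 * d) ^ d / ((ℓ : ℝ) + 1) ^ d) * (2 * ((ρ₀ + ℓ + d * ((ℓ : ℤ) + 2) : ℤ) : ℝ) + 1) ^ d + 2) *
        (64 * (2 : ℝ) ^ d * d * (c₁ + c₂) * (2 * ((ρ₀ + ℓ + d * ((ℓ : ℤ) + 2) : ℤ) : ℝ) + 1)) ^ 2 := by
  classical
  -- the divergence-form source of `−ΔX_μ`
  set G : Zd d → Fin d → ℝ := fun y ν =>
    (X y ν + X (y + unitVec ν) μ - X (y + unitVec μ) ν - X y μ) + (if ν = μ then -dvg X (y + unitVec μ) else 0) with hG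
  have hEq : ∀ y ∈ box z (ρ₀ + ℓ + d * ((ℓ : ℤ) + 2)), lop 0 (fun y => X y μ) y = dvg G y := by
    intro y _
    rw [lop_comp_eq_dvg_add_fdiff_dvg X μ y, hG, dvg_add', dvg_diag_shift]
  have hGb : ∀ y ∈ box z (ρ₀ + ℓ + d * ((ℓ : ℤ) + 2) + 1), ∀ ν, |G y ν| ≤ c₁ + c₂ := by
    intro y hy ν
    have h1 := hC y hy ν μ
    have h2 : |(if ν = μ then -dvg X (y + unitVec μ) else 0 : ℝ)| ≤ c₂ := by
      split_ifs
      · rw [abs_neg]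
        exact hDv _ (by simpa [add_assoc] using add_unitVec_mem_box hy μ)
      · rw [abs_zero]; exact hc₂
    calc |G y ν| ≤ |X y ν + X (y + unitVec ν) μ - X (y + unitVec μ) ν - X y μ| + |(if ν = μ then -dvg X (y + unitVec μ) else 0 : ℝ)| :=
          abs_add_le _ _
      _ ≤ c₁ + c₂ := add_le_add h1 h2
  exact sq_le_of_lop_eq_dvg hd hℓ hρ₀ (fun y => X y μ) G (by positivity) hEq hGb hx

end Zd

/-! ## §3 The torus `T^{(j)}`: curl and divergence bounds along the periodic pullback -/

section Torus

variable {P : Params} {j : ℕ}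

/-- The inline plaquette expression is bounded by `c₁` at `(y; ν, μ)` for ALL `ν, μ` as soon as `|curl 1 X| ≤ c₁` on every plaquette based at `y`
(`c₁ ≥ 0`; cases `ν < μ`, `ν = μ`, `μ < ν` via brick 1's `plaq_eq_curl`∕`plaq_self`∕`plaq_eq_neg_curl`). [cite: Balaban1984PropagatorsI, (1.2) p.18] -/
theorem abs_plaq_le_of_abs_curl_le (X : PBond P j → ℝ) (y : Site P j) {c₁ : ℝ} (hc₁ : 0 ≤ c₁)
    (h : ∀ (ν μ : Fin P.d) (hνμ : ν < μ), |curl 1 X ⟨y, ν, μ, hνμ⟩| ≤ c₁) (ν μ : Fin P.d) :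
    |X ⟨y, ν⟩ + X ⟨y.shift ν, μ⟩ - X ⟨y.shift μ, ν⟩ - X ⟨y, μ⟩| ≤ c₁ := by
  rcases lt_trichotomy ν μ with hlt | rfl | hgt
  · rw [plaq_eq_curl X y hlt]; exact h ν μ hlt
  · rw [plaq_self X y ν, abs_zero]; exact hc₁
  · rw [plaq_eq_neg_curl X y hgt, abs_neg]; exact h μ ν hgt

/-- ★★ **THE SOURCED MEAN-VALUE ESTIMATE ON THE TORUS `T^{(j)}`**, read through the periodic pullback along `transl x₀ : ℤ^d → Site P j` (no period or
injectivity hypothesis): `d ≥ 1`, `ℓ ≥ 1`, `ρ₀ ≥ 0`, `R := ρ₀ + ℓ + d(ℓ+2)`, `c₁, c₂ ≥ 0`; if `|curl 1 X| ≤ c₁` on every plaquette based at a site `transl x₀ w`,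
`w ∈ Q_{R+1}(0)`, and `|diverg 1 X (transl x₀ w)| ≤ c₂` for `w ∈ Q_{R+2}(0)`, then for every `z′ ∈ Q_{ρ₀}(0)` and every direction `μ`:
`X⟨transl x₀ z′, μ⟩² ≤ 4K·Σ_{w ∈ Q_R(0)} X⟨transl x₀ w, μ⟩² + (4K(2R+1)^d + 2)·(64·2^d·d·(c₁+c₂)·(2R+1))²`, `K = 2^d(1+56d)^d(ℓ+1)^{−d}` — the flat linear
core of route R's interior regularity input WITH SOURCES, in `LatticeFieldCalculus` letters. [folklore]
[cite: Giaquinta1984, Ch. III §2 (2.5) p.78; Balaban1984PropagatorsI, (1.21) p.21; Balaban1984PropagatorsII, (1.9) p.226] -/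
theorem sq_le_of_curl_diverg_bounds_torus (hd : 1 ≤ P.d) (x₀ : Site P j) (X : PBond P j → ℝ) {ℓ : ℕ} (hℓ : 1 ≤ ℓ) {ρ₀ : ℤ} (hρ₀ : 0 ≤ ρ₀)
    {c₁ c₂ : ℝ} (hc₁ : 0 ≤ c₁) (hc₂ : 0 ≤ c₂)
    (hC : ∀ w ∈ box (0 : Zd P.d) (ρ₀ + ℓ + P.d * ((ℓ : ℤ) + 2) + 1), ∀ (ν μ : Fin P.d) (hνμ : ν < μ),
      |curl 1 X ⟨transl x₀ w, ν, μ, hνμ⟩| ≤ c₁)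
    (hDv : ∀ w ∈ box (0 : Zd P.d) (ρ₀ + ℓ + P.d * ((ℓ : ℤ) + 2) + 2), |diverg 1 X (transl x₀ w)| ≤ c₂)
    {z' : Zd P.d} (hz' : z' ∈ box (0 : Zd P.d) ρ₀) (μ : Fin P.d) :
    X ⟨transl x₀ z', μ⟩ ^ 2 ≤
      4 * ((2 : ℝ) ^ P.d * (1 + 56 * P.d) ^ P.d / ((ℓ : ℝ) + 1) ^ P.d) *
          ∑ w ∈ box (0 : Zd P.d) (ρ₀ + ℓ + P.d * ((ℓ : ℤ) + 2)), X ⟨transl x₀ w, μ⟩ ^ 2 +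
        (4 * ((2 : ℝ) ^ P.d * (1 + 56 * P.d) ^ P.d / ((ℓ : ℝ) + 1) ^ P.d) * (2 * ((ρ₀ + ℓ + P.d * ((ℓ : ℤ) + 2) : ℤ) : ℝ) + 1) ^ P.d + 2) *
          (64 * (2 : ℝ) ^ P.d * P.d * (c₁ + c₂) * (2 * ((ρ₀ + ℓ + P.d * ((ℓ : ℤ) + 2) : ℤ) : ℝ) + 1)) ^ 2 := by
  refine sq_le_of_curl_div_bounds hd hℓ hρ₀ (fun w ν => X ⟨transl x₀ w, ν⟩) hc₁ hc₂ (fun w hw ν μ' => ?_) (fun w hw => ?_) hz' μ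
  · rw [plaq_pullback_eq]
    exact abs_plaq_le_of_abs_curl_le X _ hc₁ (hC w hw) ν μ'
  · rw [dvg_pullback_eq_diverg]
    exact hDv w hw

end Torus

end Summit.QuantumFields.YangMills.Theorems.Prop7FlatSourcedMeanValue

end
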